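import Literature.Computability.Cryptography.RegevSamplerWindows
import Literature.Computability.Cryptography.RegevSamplerBounds
import Literature.Computability.Cryptography.RegevSamplerSizes
import Literature.Algebra.EuclideanLattices.GapCVPCoNPSample
import HarnessLib

/-!
# Regev 2009, Lemma 3.14 in machine form: the register schedule and its windows

Topic `Literature/Computability/Cryptography`, grouping namespace `Regev2009.SamplerRegs`; sequel of
`RegevSamplerWindows.lean`, `RegevSamplerYBound.lean`, `RegevSamplerBounds.lean`, `RegevSamplerSizes.lean`.
Regev's proof of Lemma 3.14 takes the grid parameter `R = 2^{ℓ_R}` "large enough" and the registers "long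
enough". This file FIXES such a choice as explicit polynomials in four numbers — the dimension `n`, a bound
`e ≥ |code B|` on the instance code, a bound `T` on `|log₂ t|` of the stage width, and a precision parameter
`m` — and proves that it satisfies every numeric window of the machine bound `tvDist_machineCirc_le(_tab)`:

* `schedR n e T m = e(2e+2) + 2ne + 3T + 3e + m + 8` (residue register `ℓ_R`), `schedL = schedR + 2ne + T + e + 1`
  (cell register `ℓ`), `schedY n e = 2ne + e(2e+2) + 2` (branch register `ℓ_Y`), `schedB n e T = 2ne + T + 4e + 4`
  (answer width `b_c ≤ ℓ_R`);
* the grid scale window `2^{ℓ_R − T} ≤ D_t ≤ 2^{ℓ_R + 2ne + T}` (`two_pow_le_DT`, `DT_le_two_pow`);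
* the rounding error `Y ≤ 2^{-(2ne + 2T + 3e + m + 8)}` (`Ysz_le_sched`), whence `hδ`, `hC` (with `C = 16·2⁻¹ⁿ`),
  `2πBY ≤ 1`, `hfit`, `hRmin`, `hRdec`, `hyr`, `hmr`, `2^j ≤ D_t` with `ℓ + 4 + (m+2) ≤ 2j` (for `hηc`,
  `c ≤ 1`, `1 ≤ S` and `etaCos ≤ (6ℓ+1)2⁻ᵐ`).

Everything here is proved; no named fact is introduced.

## References

* O. Regev, *On lattices, learning with errors, random linear codes, and cryptography*, J. ACM 56 (2009),
  art. 34, Lemma 3.14 (proof), §2 p. 11 [Regev2009].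
* D. Micciancio, S. Goldwasser, *Complexity of Lattice Problems*, Kluwer 2002, Ch. 1 §1.2 [MicciancioGoldwasser2002].
-/

noncomputable section

namespace Literature.Computability.Cryptography

namespace Regev2009

namespace SamplerRegs

open Literature.Algebra.EuclideanLattices Literature.Algebra.EuclideanLattices.Regev2009 Peikert2009 Finset Module
  SamplerArith SamplerGeom SamplerBounds SamplerWords
open scoped Real

/-! ### The schedule -/

/-- **The residue register length** `ℓ_R = e(2e+2) + 2ne + 3T + 3e + m + 8`. [cite: Regev2009, Lemma 3.14 (proof: "R = 2^{poly} large enough")] -/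
def schedR (n e T m : ℕ) : ℕ := e * (2 * e + 2) + 2 * n * e + 3 * T + 3 * e + m + 8

/-- **The cell register length** `ℓ = ℓ_R + 2ne + T + e + 1`. [cite: Regev2009, Lemma 3.14 (proof)] -/
def schedL (n e T m : ℕ) : ℕ := schedR n e T m + 2 * n * e + T + e + 1

/-- **The branch register length** `ℓ_Y = 2ne + e(2e+2) + 2`. [cite: Regev2009, Lemma 3.14 (proof)] -/
def schedY (n e : ℕ) : ℕ := 2 * n * e + e * (2 * e + 2) + 2

/-- **The answer width** `b_c = 2ne + T + 4e + 4`. [cite: Regev2009, Lemma 3.14 (proof)] -/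
def schedB (n e T : ℕ) : ℕ := 2 * n * e + T + 4 * e + 4

/-- `b_c ≤ ℓ_R`. [folklore] -/
theorem schedB_le_schedR (n e T m : ℕ) (he : 2 ≤ e) : schedB n e T ≤ schedR n e T m := by
  unfold schedB schedR; nlinarith

/-- `T ≤ ℓ_R`. [folklore] -/
theorem T_le_schedR (n e T m : ℕ) : T ≤ schedR n e T m := by unfold schedR; omega

/-- The window exponent `j = ℓ_R − T` satisfies `ℓ + 4 + (m+2) ≤ 2j` and `2 ≤ j`. [folklore] -/
theorem schedL_window (n e T m : ℕ) :
    schedL n e T m + 4 + (m + 2) ≤ 2 * (schedR n e T m - T) ∧ 2 ≤ schedR n e T m - T := by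
  unfold schedL schedR; omega

/-! ### Elementary size facts -/

variable (I : LatticeInstance)

/-- `√n ≤ 2^e` when `n ≤ e`. [folklore] -/
theorem sqrt_n_le_two_pow {e : ℕ} (hne : I.n ≤ e) : Real.sqrt I.n ≤ (2 : ℝ) ^ e := by
  have h1 : Real.sqrt I.n ≤ I.n := by
    rcases Nat.eq_zero_or_pos I.n with h0 | hpos
    · simp [h0]
    · have hn1 : (1 : ℝ) ≤ I.n := by exact_mod_cast hpos
      calc Real.sqrt I.n ≤ Real.sqrt ((I.n : ℝ) ^ 2) :=
            Real.sqrt_le_sqrt (by nlinarith)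
        _ = I.n := Real.sqrt_sq (by positivity)
  have h2 : (I.n : ℝ) ≤ (2 : ℝ) ^ e := by
    have : I.n < 2 ^ e := lt_of_le_of_lt hne Nat.lt_two_pow_self
    exact_mod_cast this.le
  exact h1.trans h2

/-- `√n + 2 ≤ 2^e` when `n ≤ e`, `2 ≤ e`. [folklore] -/
theorem sqrt_n_add_two_le {e : ℕ} (hne : I.n ≤ e) (he : 2 ≤ e) : Real.sqrt I.n + 2 ≤ (2 : ℝ) ^ e := by
  have h1 : Real.sqrt I.n ≤ I.n := by
    rcases Nat.eq_zero_or_pos I.n with h0 | hpos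
    · simp [h0]
    · have hn1 : (1 : ℝ) ≤ I.n := by exact_mod_cast hpos
      calc Real.sqrt I.n ≤ Real.sqrt ((I.n : ℝ) ^ 2) :=
            Real.sqrt_le_sqrt (by nlinarith)
        _ = I.n := Real.sqrt_sq (by positivity)
  have h2 : (I.n : ℝ) + 2 ≤ (2 : ℝ) ^ e := by
    -- `e + 2 ≤ 2^e` for `e ≥ 2` (cf. `Literature.RingTheory.MvPolynomial.add_two_le_two_pow`, not imported here)
    have he2 : e + 2 ≤ 2 ^ e := by
      obtain ⟨k, rfl⟩ := Nat.exists_eq_add_of_le he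
      have h := Nat.lt_two_pow_self (n := k)
      rw [pow_add]; omega
    have : I.n + 2 ≤ 2 ^ e := (Nat.add_le_add_right hne 2).trans he2
    exact_mod_cast this
  linarith

variable [hZ : IsZLattice ℝ I.lattice]

omit hZ in
/-- `|det B| ≤ 2^{2ne}` for `|code B| ≤ e`. [cite: MicciancioGoldwasser2002, Ch. 1 §1.2] -/
theorem cast_detA_le {e : ℕ} (he : I.encode.length ≤ e) : (detA I : ℝ) ≤ (2 : ℝ) ^ (2 * I.n * e) :=
  (cast_detA_le_two_pow I).trans (pow_le_pow_right₀ one_le_two (by rw [mul_assoc]; exact Nat.mul_le_mul_left _ (Nat.mul_le_mul_left _ he)))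

/-- `Σⱼ ‖b∨ⱼ‖ ≤ 2^{e(2e+2)}` for `|code B| ≤ e`. [cite: Regev2009, Lemma 3.14 (proof)] -/
theorem sum_norm_dualVec_le {e : ℕ} (he : I.encode.length ≤ e) : ∑ j, ‖dualVec I j‖ ≤ (2 : ℝ) ^ (e * (2 * e + 2)) :=
  (sum_norm_dualVec_le_two_pow_length I).trans
    (pow_le_pow_right₀ one_le_two (Nat.mul_le_mul he (by omega)))

omit hZ in
/-- `‖bⱼ‖ ≤ 2^{2e}` for `|code B| ≤ e` (`‖bⱼ‖ ≤ n·2^{|code B|}`, `n ≤ |code B|`). [cite: MicciancioGoldwasser2002, Ch. 1 §1.2] -/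
theorem norm_vec_le_two_pow {e : ℕ} (he : I.encode.length ≤ e) (j : Fin I.n) : ‖I.vec j‖ ≤ (2 : ℝ) ^ (2 * e) := by
  have h := LatticeInstance.norm_vec_le I (M := 2 ^ I.encode.length) (fun i k => (RegevRoutine.natAbs_entry_lt I i k).le) j
  have hn : (I.n : ℝ) ≤ (2 : ℝ) ^ e := by
    have : I.n < 2 ^ e := lt_of_le_of_lt (I.n_le_length_encode.trans he) Nat.lt_two_pow_self
    exact_mod_cast this.le
  have hM : ((2 ^ I.encode.length : ℕ) : ℝ) ≤ (2 : ℝ) ^ e := by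
    push_cast; exact pow_le_pow_right₀ one_le_two he
  calc ‖I.vec j‖ ≤ I.n * ((2 ^ I.encode.length : ℕ) : ℝ) := h
    _ ≤ 2 ^ e * 2 ^ e := mul_le_mul hn hM (by positivity) (by positivity)
    _ = (2 : ℝ) ^ (2 * e) := by rw [← pow_add]; ring_nf

/-! ### The grid scale window -/

/-- **`2^{ℓ_R − T} ≤ D_t`** for `0 < t ≤ 2^T`, `T ≤ ℓ_R` (`|det B| ≥ 1`). [cite: Regev2009, Lemma 3.14 (proof)] -/
theorem two_pow_le_DT {t : ℝ} (ht : 0 < t) {T ℓR : ℕ} (htT : t ≤ (2 : ℝ) ^ T) (hT : T ≤ ℓR) :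
    (2 : ℝ) ^ (ℓR - T) ≤ DT I (2 ^ ℓR) t := by
  have hdet : (1 : ℝ) ≤ detA I := by exact_mod_cast Nat.one_le_iff_ne_zero.2 (detA_ne_zero (I := I))
  unfold DT Dg
  rw [le_div_iff₀ ht]
  push_cast
  calc (2 : ℝ) ^ (ℓR - T) * t ≤ 2 ^ (ℓR - T) * 2 ^ T := mul_le_mul_of_nonneg_left htT (by positivity)
    _ = 2 ^ ℓR := by rw [← pow_add, Nat.sub_add_cancel hT]
    _ ≤ 2 ^ ℓR * (detA I : ℝ) := le_mul_of_one_le_right (by positivity) hdet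

omit hZ in
/-- **`D_t ≤ 2^{ℓ_R + 2ne + T}`** for `2^{-T} ≤ t`, `|code B| ≤ e`. [cite: Regev2009, Lemma 3.14 (proof)] -/
theorem DT_le_two_pow {t : ℝ} {T ℓR e : ℕ} (hTt : (2⁻¹ : ℝ) ^ T ≤ t) (he : I.encode.length ≤ e) :
    DT I (2 ^ ℓR) t ≤ (2 : ℝ) ^ (ℓR + 2 * I.n * e + T) := by
  have ht : 0 < t := lt_of_lt_of_le (by positivity) hTt
  unfold DT Dg
  rw [div_le_iff₀ ht]
  push_cast
  have h1 : (2 : ℝ) ^ ℓR * (detA I : ℝ) ≤ 2 ^ ℓR * 2 ^ (2 * I.n * e) := mul_le_mul_of_nonneg_left (cast_detA_le I he) (by positivity)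
  have h2 : (2 : ℝ) ^ (ℓR + 2 * I.n * e + T) * (2⁻¹ : ℝ) ^ T = 2 ^ ℓR * 2 ^ (2 * I.n * e) := by
    rw [pow_add, pow_add, inv_pow, mul_assoc, mul_inv_cancel₀ (by positivity), mul_one]
  calc (2 : ℝ) ^ ℓR * (detA I : ℝ) ≤ 2 ^ ℓR * 2 ^ (2 * I.n * e) := h1
    _ = (2 : ℝ) ^ (ℓR + 2 * I.n * e + T) * (2⁻¹ : ℝ) ^ T := h2.symm
    _ ≤ (2 : ℝ) ^ (ℓR + 2 * I.n * e + T) * t := mul_le_mul_of_nonneg_left hTt (by positivity)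

/-! ### The rounding error under the schedule -/

variable {W : ℕ} (Λ : SamplerClassical.Layout W I.n)

/-- **`Y ≤ 2^{-(2ne + 2T + 3e + m + 8)}`** under the schedule (`0 ≤ t ≤ 2^T`). [cite: Regev2009, Lemma 3.14 (proof)] -/
theorem Ysz_le_sched {t : ℝ} (ht : 0 ≤ t) {T e m : ℕ} (htT : t ≤ (2 : ℝ) ^ T) (he : I.encode.length ≤ e)
    (hR : Λ.ℓR = schedR I.n e T m) :
    Ysz I Λ t ≤ (2⁻¹ : ℝ) ^ (2 * I.n * e + 2 * T + 3 * e + m + 8) := by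
  have hj : I.encode.length * (2 * I.encode.length + 2) + (2 * I.n * e + 3 * T + 3 * e + m + 8) ≤ Λ.ℓR := by
    rw [hR]; unfold schedR
    have := Nat.mul_le_mul he (by omega : 2 * I.encode.length + 2 ≤ 2 * e + 2)
    omega
  have h := Ysz_le_of_le_ℓR I Λ ht hj
  calc Ysz I Λ t ≤ t * (2⁻¹ : ℝ) ^ (2 * I.n * e + 3 * T + 3 * e + m + 8) := h
    _ ≤ (2 : ℝ) ^ T * (2⁻¹ : ℝ) ^ (2 * I.n * e + 3 * T + 3 * e + m + 8) := mul_le_mul_of_nonneg_right htT (by positivity)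
    _ = (2⁻¹ : ℝ) ^ (2 * I.n * e + 2 * T + 3 * e + m + 8) := by
        rw [show 2 * I.n * e + 3 * T + 3 * e + m + 8 = T + (2 * I.n * e + 2 * T + 3 * e + m + 8) by ring, pow_add,
          ← mul_assoc, inv_pow, mul_inv_cancel₀ (by positivity), one_mul, inv_pow]

/-- The rounding error is below `1`, `1/16`, `2⁻ᵐ`, and `2√n·Y ≤ 1/16`, under the schedule. [folklore] -/
theorem Ysz_small {t : ℝ} (ht : 0 ≤ t) {T e m : ℕ} (htT : t ≤ (2 : ℝ) ^ T) (he : I.encode.length ≤ e) (hne : I.n ≤ e)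
    (hR : Λ.ℓR = schedR I.n e T m) :
    Ysz I Λ t ≤ 1 ∧ Ysz I Λ t ≤ 16⁻¹ ∧ Ysz I Λ t ≤ (2⁻¹ : ℝ) ^ m ∧ 2 * Real.sqrt I.n * Ysz I Λ t ≤ 16⁻¹ := by
  have hY := Ysz_le_sched I Λ ht htT he hR
  have hY0 := Ysz_nonneg I Λ ht
  set K := 2 * I.n * e + 2 * T + 3 * e + m + 8 with hK
  have hh : (0 : ℝ) < 2⁻¹ := by norm_num
  have hle1 : (2⁻¹ : ℝ) ≤ 1 := by norm_num
  have hK4 : (2⁻¹ : ℝ) ^ K ≤ (2⁻¹ : ℝ) ^ 4 := pow_le_pow_of_le_one hh.le hle1 (by omega)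
  have hKm : (2⁻¹ : ℝ) ^ K ≤ (2⁻¹ : ℝ) ^ m := pow_le_pow_of_le_one hh.le hle1 (by omega)
  have hK1 : (2⁻¹ : ℝ) ^ K ≤ 1 := pow_le_one₀ hh.le hle1
  have hKe : (2⁻¹ : ℝ) ^ K ≤ (2⁻¹ : ℝ) ^ (e + 5) := pow_le_pow_of_le_one hh.le hle1 (by omega)
  have hs := sqrt_n_le_two_pow I hne
  refine ⟨hY.trans hK1, hY.trans (hK4.trans (by norm_num)), hY.trans hKm, ?_⟩
  calc 2 * Real.sqrt I.n * Ysz I Λ t ≤ 2 * 2 ^ e * (2⁻¹ : ℝ) ^ (e + 5) :=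
        mul_le_mul (mul_le_mul_of_nonneg_left hs (by norm_num)) (hY.trans hKe) hY0 (by positivity)
    _ = 16⁻¹ := by rw [pow_add, inv_pow, inv_pow]; field_simp; ring

/-! ### The windows of the machine bound under the schedule -/

/-- **`hfit`** under the schedule. [cite: Regev2009, Lemma 3.14 (proof)] -/
theorem hfit_sched {t : ℝ} (ht : 0 < t) {T e m : ℕ} (htT : t ≤ (2 : ℝ) ^ T) (hTt : (2⁻¹ : ℝ) ^ T ≤ t)
    (he : I.encode.length ≤ e) (hne : I.n ≤ e) (he2 : 2 ≤ e)
    (hR : Λ.ℓR = schedR I.n e T m) (hL : Λ.ℓ = schedL I.n e T m) :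
    DT I (2 ^ Λ.ℓR) t * (Real.sqrt I.n + Ysz I Λ t) + 1 ≤ (2 : ℝ) ^ (Λ.ℓ - 1) := by
  obtain ⟨hY1, -, -, -⟩ := Ysz_small I Λ ht.le htT he hne hR
  refine hfit_of (A := Λ.ℓR + 2 * I.n * e + T) (B := e) (DT_le_two_pow I hTt he) (Ysz_nonneg I Λ ht.le) hY1
    (sqrt_n_add_two_le I hne he2) ?_
  rw [hL, hR]; unfold schedL; omega

omit hZ in
/-- **`hRmin`** under the schedule (`λ₁(L) ≥ 1`). [cite: MicciancioGoldwasser2002, Ch. 1 §1.2] -/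
theorem hRmin_sched (hI : I.IsNonsingular) (hn : 1 ≤ I.n) {t : ℝ} (ht : 0 < t) {T e m : ℕ} (htT : t ≤ (2 : ℝ) ^ T)
    (hne : I.n ≤ e) (hR : Λ.ℓR = schedR I.n e T m) :
    2 * Real.sqrt (finrank ℝ (EuclideanSpace ℝ (Fin I.n))) * t ≤ (2 ^ Λ.ℓR : ℕ) * minNorm I.lattice := by
  refine hRmin_of I hI hn ?_
  rw [finrank_euclideanSpace_fin]
  have hs := sqrt_n_le_two_pow I hne
  have hℓR : e + 1 + T ≤ Λ.ℓR := by rw [hR]; unfold schedR; omega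
  calc 2 * Real.sqrt I.n * t ≤ 2 * 2 ^ e * 2 ^ T := mul_le_mul (mul_le_mul_of_nonneg_left hs (by norm_num)) htT ht.le (by positivity)
    _ = (2 : ℝ) ^ (e + 1 + T) := by rw [pow_add, pow_add, pow_one]; ring
    _ ≤ (2 : ℝ) ^ Λ.ℓR := pow_le_pow_right₀ one_le_two hℓR
    _ = ((2 ^ Λ.ℓR : ℕ) : ℝ) := by norm_num

/-- **`hRdec`** under the schedule. [cite: Regev2009, Lemma 3.14 (proof)] -/
theorem hRdec_sched {t : ℝ} (ht : 0 < t) {T e m : ℕ} (htT : t ≤ (2 : ℝ) ^ T) (he : I.encode.length ≤ e) (hne : I.n ≤ e)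
    (hR : Λ.ℓR = schedR I.n e T m) (j : Fin I.n) :
    2 * |t| * Real.sqrt (finrank ℝ (EuclideanSpace ℝ (Fin I.n))) * ‖dualVec I j‖ ≤ ((2 ^ Λ.ℓR : ℕ) : ℝ) := by
  refine hRdec_of I Λ (j₀ := T + e + 1) ?_ ?_ j
  · rw [finrank_euclideanSpace_fin, abs_of_pos ht]
    have hs := sqrt_n_le_two_pow I hne
    calc 2 * t * Real.sqrt I.n ≤ 2 * 2 ^ T * 2 ^ e := mul_le_mul (mul_le_mul_of_nonneg_left htT (by norm_num)) hs (Real.sqrt_nonneg _) (by positivity)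
      _ = (2 : ℝ) ^ (T + e + 1) := by rw [pow_add, pow_add, pow_one]; ring
  · rw [hR]; unfold schedR
    have := Nat.mul_le_mul he (by omega : 2 * I.encode.length + 2 ≤ 2 * e + 2)
    nlinarith

/-- **`hyr`** under the schedule: the branch fits `ℓ_Y = schedY` bits. [cite: Regev2009, Lemma 3.14 (proof), §2 p. 11] -/
theorem hyr_sched {e : ℕ} (he : I.encode.length ≤ e) (hY : Λ.ℓY = schedY I.n e) (x : Fin I.n → ℤ) (i : Fin I.n) :
    -2 ^ (Λ.ℓY - 1) ≤ ytil I x i ∧ ytil I x i < 2 ^ (Λ.ℓY - 1) := by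
  refine ytil_mem I x i ?_
  have h1 := cast_detA_le I he
  have h2 := sum_norm_dualVec_le I he
  have hY' : Λ.ℓY - 1 = 2 * I.n * e + e * (2 * e + 2) + 1 := by rw [hY]; unfold schedY; omega
  rw [hY']
  calc (detA I : ℝ) * ∑ j, ‖dualVec I j‖ ≤ 2 ^ (2 * I.n * e) * 2 ^ (e * (2 * e + 2)) :=
        mul_le_mul h1 h2 (sum_nonneg fun j _ => norm_nonneg _) (by positivity)
    _ = (2 : ℝ) ^ (2 * I.n * e + e * (2 * e + 2)) := by rw [pow_add]
    _ < (2 : ℝ) ^ (2 * I.n * e + e * (2 * e + 2) + 1) := pow_lt_pow_right₀ one_lt_two (by omega)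

/-- **`hmr`** under the schedule: the answer coefficients fit `b_c = schedB` bits. [cite: Regev2009, Lemma 3.14 (proof), §2 p. 11] -/
theorem hmr_sched {T e m : ℕ} (he : I.encode.length ≤ e) (hne : I.n ≤ e)
    (hR : Λ.ℓR = schedR I.n e T m) (hL : Λ.ℓ = schedL I.n e T m) (hB : Λ.bc = schedB I.n e T)
    (Yb : Fin I.n → Fin Λ.ℓ → Bool) (j : Fin I.n) :
    -2 ^ (Λ.bc - 1) ≤ -mVec I (2 ^ Λ.ℓR) (gridVec I Yb) j ∧ -mVec I (2 ^ Λ.ℓR) (gridVec I Yb) j < 2 ^ (Λ.bc - 1) := by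
  haveI : NeZero (2 ^ Λ.ℓR) := ⟨by positivity⟩
  refine neg_mVec_mem I (2 ^ Λ.ℓR) Yb j ?_
  have hdet : (1 : ℝ) ≤ detA I := by exact_mod_cast Nat.one_le_iff_ne_zero.2 (detA_ne_zero (I := I))
  have hv := norm_vec_le_two_pow I he j
  have hs := sqrt_n_le_two_pow I hne
  have hDg : (2 : ℝ) ^ Λ.ℓR ≤ (Dg I (2 ^ Λ.ℓR) : ℝ) := by
    unfold Dg; push_cast; exact le_mul_of_one_le_right (by positivity) hdet
  have hDg0 : (0 : ℝ) < (Dg I (2 ^ Λ.ℓR) : ℝ) := lt_of_lt_of_le (by positivity) hDg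
  have hq : ((Dg I (2 ^ Λ.ℓR) : ℝ))⁻¹ * (Real.sqrt I.n * 2 ^ Λ.ℓ) ≤ 2 ^ e * (2 : ℝ) ^ (2 * I.n * e + T + e + 1) := by
    rw [inv_mul_le_iff₀ hDg0]
    have hℓ : Λ.ℓ = Λ.ℓR + (2 * I.n * e + T + e + 1) := by rw [hL, hR]; unfold schedL; omega
    calc Real.sqrt I.n * (2 : ℝ) ^ Λ.ℓ ≤ 2 ^ e * 2 ^ Λ.ℓ := mul_le_mul_of_nonneg_right hs (by positivity)
      _ = 2 ^ Λ.ℓR * (2 ^ e * (2 : ℝ) ^ (2 * I.n * e + T + e + 1)) := by rw [hℓ, pow_add]; ring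
      _ ≤ (Dg I (2 ^ Λ.ℓR) : ℝ) * (2 ^ e * (2 : ℝ) ^ (2 * I.n * e + T + e + 1)) := mul_le_mul_of_nonneg_right hDg (by positivity)
  have hB' : Λ.bc - 1 = 2 * I.n * e + T + 4 * e + 3 := by rw [hB]; unfold schedB; omega
  rw [hB']
  calc ‖I.vec j‖ * (((Dg I (2 ^ Λ.ℓR) : ℝ))⁻¹ * (Real.sqrt I.n * 2 ^ Λ.ℓ)) + 1
      ≤ 2 ^ (2 * e) * (2 ^ e * (2 : ℝ) ^ (2 * I.n * e + T + e + 1)) + 1 := by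
        have hprod := mul_le_mul hv hq (by positivity) (by positivity)
        linarith
    _ = (2 : ℝ) ^ (2 * I.n * e + T + 4 * e + 1) + 1 := by rw [← pow_add, ← pow_add]; ring_nf
    _ < (2 : ℝ) ^ (2 * I.n * e + T + 4 * e + 3) := by
        have h1 : (1 : ℝ) ≤ (2 : ℝ) ^ (2 * I.n * e + T + 4 * e + 1) := one_le_pow₀ one_le_two
        have h4 : (2 : ℝ) ^ (2 * I.n * e + T + 4 * e + 3) = 2 ^ (2 * I.n * e + T + 4 * e + 1) * 4 := by ring
        rw [h4]; linarith

/-- **`2πBY ≤ 1`** under the schedule (`B = √n 2^ℓ/D_t + Y`). [cite: Regev2009, Lemma 3.14 (proof)] -/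
theorem hBY_sched {t : ℝ} (ht : 0 < t) {T e m : ℕ} (htT : t ≤ (2 : ℝ) ^ T) (he : I.encode.length ≤ e) (hne : I.n ≤ e)
    (hR : Λ.ℓR = schedR I.n e T m) (hL : Λ.ℓ = schedL I.n e T m) :
    2 * π * Bsz I Λ t * Ysz I Λ t ≤ 1 := by
  have hY := Ysz_le_sched I Λ ht.le htT he hR
  have hY0 := Ysz_nonneg I Λ ht.le
  have hD := two_pow_le_DT I ht htT (T_le_schedR I.n e T m)
  rw [← hR] at hD
  have hs := sqrt_n_le_two_pow I hne
  unfold Bsz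
  refine hBY_of (j := Λ.ℓR - T) (jB := 2 * I.n * e + 2 * T + 3 * e + m + 8) hD hY0 hY ?_ ?_
  · have hexp : Λ.ℓ + (2 * e + m + 7) = (Λ.ℓR - T) + (2 * I.n * e + 2 * T + 3 * e + m + 8) := by
      rw [hL, hR]; unfold schedL schedR; omega
    have key : (2 : ℝ) ^ Λ.ℓ * (2⁻¹ : ℝ) ^ (Λ.ℓR - T) * (2⁻¹ : ℝ) ^ (2 * I.n * e + 2 * T + 3 * e + m + 8) = (2⁻¹ : ℝ) ^ (2 * e + m + 7) := by
      rw [mul_assoc, ← pow_add, ← hexp, pow_add, inv_pow, inv_pow, ← mul_assoc, mul_inv_cancel₀ (by positivity), one_mul]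
    calc Real.sqrt I.n * 2 ^ Λ.ℓ * (2⁻¹ : ℝ) ^ (Λ.ℓR - T) * (2⁻¹ : ℝ) ^ (2 * I.n * e + 2 * T + 3 * e + m + 8)
        = Real.sqrt I.n * (2 ^ Λ.ℓ * (2⁻¹ : ℝ) ^ (Λ.ℓR - T) * (2⁻¹ : ℝ) ^ (2 * I.n * e + 2 * T + 3 * e + m + 8)) := by ring
      _ = Real.sqrt I.n * (2⁻¹ : ℝ) ^ (2 * e + m + 7) := by rw [key]
      _ ≤ 2 ^ e * (2⁻¹ : ℝ) ^ (2 * e + m + 7) := mul_le_mul_of_nonneg_right hs (by positivity)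
      _ = (2⁻¹ : ℝ) ^ (e + m + 7) := by rw [show 2 * e + m + 7 = e + (e + m + 7) by ring, pow_add, inv_pow, inv_pow, ← mul_assoc, mul_inv_cancel₀ (by positivity), one_mul]
      _ ≤ (2⁻¹ : ℝ) ^ 4 := pow_le_pow_of_le_one (by norm_num) (by norm_num) (by omega)
      _ ≤ 16⁻¹ := by norm_num
  · calc (2⁻¹ : ℝ) ^ (2 * I.n * e + 2 * T + 3 * e + m + 8) ≤ (2⁻¹ : ℝ) ^ 4 := pow_le_pow_of_le_one (by norm_num) (by norm_num) (by omega)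
      _ ≤ 16⁻¹ := by norm_num

/-- **`hδ` and `hC` (with `C = 16·2⁻¹ⁿ`)** under the schedule. [cite: Regev2009, Lemma 3.14 (proof)] -/
theorem hδ_hC_sched (hn : 1 ≤ I.n) {t : ℝ} (ht : 0 < t) {T e m : ℕ} (htT : t ≤ (2 : ℝ) ^ T) (he : I.encode.length ≤ e)
    (hne : I.n ≤ e) (hR : Λ.ℓR = schedR I.n e T m) (hL : Λ.ℓ = schedL I.n e T m) :
    π * (2 * Real.sqrt (finrank ℝ (EuclideanSpace ℝ (Fin I.n))) * Ysz I Λ t + Ysz I Λ t ^ 2) < 1 ∧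
    Real.exp (2 * π * Bsz I Λ t * Ysz I Λ t) * (2⁻¹ : ℝ) ^ finrank ℝ (EuclideanSpace ℝ (Fin I.n)) ≤
      tailC I.n * ((1 - π * (2 * Real.sqrt (finrank ℝ (EuclideanSpace ℝ (Fin I.n))) * Ysz I Λ t + Ysz I Λ t ^ 2)) *
        (1 - banaConst ^ finrank ℝ (EuclideanSpace ℝ (Fin I.n))) * (1 - (4⁻¹ : ℝ) ^ finrank ℝ (EuclideanSpace ℝ (Fin I.n)))) := by
  obtain ⟨-, hY16, -, hsY⟩ := Ysz_small I Λ ht.le htT he hne hR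
  have hY0 := Ysz_nonneg I Λ ht.le
  rw [finrank_euclideanSpace_fin]
  have hhalf := pi_mul_le_half hY0 hY16 hsY
  exact ⟨hδ_of_le_half hhalf, hC_of_le_half hn hhalf (hBY_sched I Λ ht htT he hne hR hL)⟩

/-- **The grid-scale exponent**: `2^j ≤ D_t` with `j = ℓ_R − T`, `ℓ + 4 + (m+2) ≤ 2j` and `2 ≤ j` — the inputs of
`hηc_of` / `hηc_pow_of`, `c_le_one_of`, `two_le_sq_of` and `etaCos_window_le`. [cite: Regev2009, Lemma 3.12 (proof)] -/
theorem window_sched {t : ℝ} (ht : 0 < t) {T e m : ℕ} (htT : t ≤ (2 : ℝ) ^ T)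
    (hR : Λ.ℓR = schedR I.n e T m) (hL : Λ.ℓ = schedL I.n e T m) :
    (2 : ℝ) ^ (Λ.ℓR - T) ≤ DT I (2 ^ Λ.ℓR) t ∧ Λ.ℓ + 4 + (m + 2) ≤ 2 * (Λ.ℓR - T) ∧ 2 ≤ Λ.ℓR - T := by
  have hD := two_pow_le_DT I ht htT (T_le_schedR I.n e T m)
  rw [← hR] at hD
  have hw := schedL_window I.n e T m
  rw [← hR, ← hL] at hw
  exact ⟨hD, hw⟩

end SamplerRegs

end Regev2009

end Literature.Computability.Cryptography

end
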